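import Mathlib
import Summits.RiemannHypothesis.RiemannHypothesis.Theorems.SuzukiWindowsDoorTemple

/-!
# Temple's inequality — the mirror statement for the bottom of the spectrum (RH-free, K-general)

Companion of `SuzukiWindowsDoorTemple` (p445999): the same certificate applied to `−T` gives the LOWER
enclosure of `λ_min` used by the rh-dbr ET1e legs (json fields `temple.eta_minus / a_minus / r2_minus`):
a codimension-one lower form bound `−a‖g‖² ≤ ⟪T g, g⟫` on `ker L` plus Ritz data for the bottom give
`−(η₂ + r₂/(η₁ − a))‖f‖² ≤ ⟪T f, f⟫` for all `f`; concretely for the window operator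
`SuzukiWindowsDoorOpPath.op hK t`.  RH-FREE operator theory; nothing here bears on the truth of RH.

References: G. Temple, Proc. R. Soc. A 119 (1928); T. Kato, J. Phys. Soc. Japan 4 (1949).
-/

set_option linter.dupNamespace false

namespace Summit.RiemannHypothesis.RiemannHypothesis.Theorems.SuzukiWindowsDoorTemple

open RealInnerProductSpace

variable {E : Type*} [NormedAddCommGroup E] [InnerProductSpace ℝ E]

/-- **Mirror (bottom of the spectrum).** Temple's certificate for `−T`: a codimension-one LOWER form bound
`−a‖g‖² ≤ ⟪T g, g⟫` on `ker L` and Ritz data for the bottom (`η₁ ≤ −⟪T u, u⟫ ≤ η₂`, `‖T u‖² − ⟪T u, u⟫² ≤ r₂`,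
`a < η₁`, `0 < η₁`) give `−(η₂ + r₂/(η₁ − a)) ‖f‖² ≤ ⟪T f, f⟫` for all `f` — the lower enclosure of `λ_min`.
[folklore: Temple 1928] -/
theorem temple_certificate_le_inner [CompleteSpace E] (T : E →L[ℝ] E)
    (hsym : ∀ x y : E, ⟪T x, y⟫ = ⟪x, T y⟫) (hc : IsCompactOperator T)
    (L : E →ₗ[ℝ] ℝ) {a : ℝ} (hL : ∀ g : E, L g = 0 → -(a * ‖g‖ ^ 2) ≤ ⟪T g, g⟫)
    {u : E} (hu : ‖u‖ = 1) {η₁ η₂ r₂ : ℝ} (hη₁ : η₁ ≤ -⟪T u, u⟫) (hη₂ : -⟪T u, u⟫ ≤ η₂)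
    (hr₂ : ‖T u‖ ^ 2 - ⟪T u, u⟫ ^ 2 ≤ r₂) (ha : a < η₁) (hpos : 0 < η₁) (f : E) :
    -((η₂ + r₂ / (η₁ - a)) * ‖f‖ ^ 2) ≤ ⟪T f, f⟫ := by
  have hneg : ∀ x : E, (-T) x = -(T x) := fun x => rfl
  have hsym' : ∀ x y : E, ⟪(-T) x, y⟫ = ⟪x, (-T) y⟫ := fun x y => by
    simp only [hneg, inner_neg_left, inner_neg_right, hsym]
  have hL' : ∀ g : E, L g = 0 → ⟪(-T) g, g⟫ ≤ a * ‖g‖ ^ 2 := fun g hg => by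
    simp only [hneg, inner_neg_left]; linarith [hL g hg]
  have hη₁' : η₁ ≤ ⟪(-T) u, u⟫ := by simpa only [hneg, inner_neg_left] using hη₁
  have hη₂' : ⟪(-T) u, u⟫ ≤ η₂ := by simpa only [hneg, inner_neg_left] using hη₂
  have hr₂' : ‖(-T) u‖ ^ 2 - ⟪(-T) u, u⟫ ^ 2 ≤ r₂ := by
    simpa only [hneg, inner_neg_left, norm_neg, neg_sq] using hr₂
  have h := inner_le_temple_certificate (-T) hsym' hc.neg L hL' hu hη₁' hη₂' hr₂' ha hpos f
  simp only [hneg, inner_neg_left] at h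
  linarith

/-- The mirror certificate for the window operator `𝖪[t]` (lower enclosure of `λ_min(𝖪[t])`; ET1e json fields
`temple.eta_minus`, `temple.a_minus`, `temple.r2_minus`). [folklore: Temple 1928] -/
theorem temple_certificate_le_inner_op {K : ℝ → ℝ} (hK : Continuous K) (t : ℝ)
    (L : MeasureTheory.Lp ℝ 2 (MeasureTheory.volume : MeasureTheory.Measure ℝ) →ₗ[ℝ] ℝ) {a : ℝ}
    (hL : ∀ g, L g = 0 → -(a * ‖g‖ ^ 2) ≤ ⟪SuzukiWindowsDoorOpPath.op hK t g, g⟫)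
    {u : MeasureTheory.Lp ℝ 2 (MeasureTheory.volume : MeasureTheory.Measure ℝ)} (hu : ‖u‖ = 1)
    {η₁ η₂ r₂ : ℝ} (hη₁ : η₁ ≤ -⟪SuzukiWindowsDoorOpPath.op hK t u, u⟫)
    (hη₂ : -⟪SuzukiWindowsDoorOpPath.op hK t u, u⟫ ≤ η₂)
    (hr₂ : ‖SuzukiWindowsDoorOpPath.op hK t u‖ ^ 2 - ⟪SuzukiWindowsDoorOpPath.op hK t u, u⟫ ^ 2 ≤ r₂)
    (ha : a < η₁) (hpos : 0 < η₁) (f : MeasureTheory.Lp ℝ 2 (MeasureTheory.volume : MeasureTheory.Measure ℝ)) :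
    -((η₂ + r₂ / (η₁ - a)) * ‖f‖ ^ 2) ≤ ⟪SuzukiWindowsDoorOpPath.op hK t f, f⟫ := by
  have hsa := SuzukiWindowsDoorOpPath.isSelfAdjoint_op hK t
  have hsym : ∀ x y, ⟪SuzukiWindowsDoorOpPath.op hK t x, y⟫ = ⟪x, SuzukiWindowsDoorOpPath.op hK t y⟫ :=
    (ContinuousLinearMap.isSelfAdjoint_iff_isSymmetric.1 hsa)
  exact temple_certificate_le_inner _ hsym (SuzukiWindowsDoorOpPath.isCompactOperator_op hK t) L hL hu hη₁ hη₂ hr₂ ha hpos f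

end Summit.RiemannHypothesis.RiemannHypothesis.Theorems.SuzukiWindowsDoorTemple
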